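import Summits.CriticalPhenomena.PercolationContinuityZ3.Theorems.PercNearOneGluingNoHeavyQuantGateMoveBlobCellsZero
import Summits.CriticalPhenomena.PercolationContinuityZ3.Theorems.PercNearOneGluingNoHeavyQuantGateMoveBlobCells
import Summits.CriticalPhenomena.PercolationContinuityZ3.Theorems.PercNearOneGluingNoHeavyQuantSliceHeavy
import Summits.CriticalPhenomena.PercolationContinuityZ3.Theorems.PercNearOneGluingNoHeavyQuantGatedSliceWindow
import HarnessLib

/-!
# QUANT lane R8, T-DEC, leg (III), blob case — `LawDec.GatedSliceMixLaw'`, the Q-ALONE side: the SHIFTED-COPY-GIANT cell (`k₁ + a ≥ j + 1`,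
# classes `G×{L,m,M,G}` of the census, `k₁ = 0` included) — `Q` is DEC by criterion E, unconditionally

builds on p205010 (kernel theorem, internal audit signed; external expert review pending)

Support file (`--supports stmt-CriticalPhenomena-4575`), QUANT lane seat prim-quant-arm-1 (gen 41), rung R8 of
`run/shared/lean/prim/quant/LADDER.md`.  Theorems only, standard axioms, no sorries, no definitions.  Companion of `…QuantGatedSliceMixLawQAlone`
(cells (Q1) `k₂ + a ≤ j`, (Q2′) no nonzero `t`-low), `…QuantGatedSliceMixLawQRouting` / `…QRoutingDeep` (parametric routings) and
`…QuantFlowPieces` (typer g26: `flowAtT_of_giants`, criterion E in flow form).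

THE CELL.  Frame of the node; `Q = zδ₀ + (1−z)·slice {k₁,k₂;λ} a g = z·δ₀ + A·δ_{k₁} + B·δ_{k₁+a} + C·δ_{k₂} + D·δ_{k₂+a}`.  If the shifted
copy `k₁ + a` is a GIANT (`j + 1 ≤ k₁ + a`; then so is `k₂ + a`), the giant mass of `Q` is at least `B + D = (1−z)g ≥ y` (threshold), so
`y·P(low) ≤ y·(1 − P(giant)) ≤ (1−y)·P(giant)`: criterion E (`flowAtT_of_giants`) — whatever the status of `k₁` and `k₂`.  EXACT CENSUS
(this seat, `work/explore/qcells.py`, `qpull2.py`): the classes `GG, GL, Gm, GM, ZGG, ZGL, ZGm, ZGM` have 0 non-DEC instances and criterion E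
certifies every one of them (≈ 56 000 instances).
HONEST STATUS: `GatedSliceMixLaw'` (regime R), CW, `GateMove`, `GatedConvEmptyFree`, `SingleGateConvClosed`, `TreeDEC`, `FarTreeRow` OPEN;
RATE class log\* / honest sentence of `run/shared/lean/prim/quant/README.md` unchanged.

* **`LawDec.mixLawQ_decAtT_of_twinGiant`** — `j + 1 ≤ k₁ + a` ⟹ `Q` is `DECAtT y t j (M+a)`.
* `LawDec.gatedSliceMixLaw'_of_twinGiant` — the node's conclusion with `θ = 0`.

[this work]; criterion E in flow form: prim-quant-stmt g26; node: prim-quant-stmt g29 (this lane).  Nothing here is cited as a published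
result.  The gluing rows served [cite: KozmaNitzan2024, Conjecture 3 (p. 15)]; product measure [cite: Grimmett1999, §1.3 p. 10].
-/

noncomputable section

namespace Summit.CriticalPhenomena.PercolationContinuityZ3.Theorems

namespace Quant

open Finset

/-- the two-point law `{lo, hi; g}` (as in `…QuantLawDEC`) -/
local notation3 "TP[" lo ", " hi ", " g ", " h "]" =>
  (g : ℝ) * (if (h : ℕ) = (hi : ℕ) then (1 : ℝ) else 0) + (1 - (g : ℝ)) * (if (h : ℕ) = (lo : ℕ) then (1 : ℝ) else 0)

namespace LawDec

/-- the five-atom form of `Q` (as in `…QuantGatedSliceMixLawQRouting`; restated to keep this file independent). -/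
private theorem mixLawQ_eq_atoms'' (z g lam : ℝ) (a k₁ k₂ : ℕ) (p : ℕ) :
    z * (if p = 0 then (1 : ℝ) else 0) + (1 - z) * slice (fun q => TP[k₁, k₂, lam, q]) a g p
      = z * (if p = 0 then (1 : ℝ) else 0) + (1 - z) * (1 - lam) * (1 - g) * (if p = k₁ then (1 : ℝ) else 0)
        + (1 - z) * (1 - lam) * g * (if p = k₁ + a then (1 : ℝ) else 0)
        + (1 - z) * lam * (1 - g) * (if p = k₂ then (1 : ℝ) else 0)
        + (1 - z) * lam * g * (if p = k₂ + a then (1 : ℝ) else 0) := by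
  rw [slice_TP]
  ring

/-- **THE SHIFTED-COPY-GIANT CELL: `j + 1 ≤ k₁ + a` ⟹ `Q` IS DEC AT `(y, t, j)`** (criterion E; see the file header). [this work] -/
theorem mixLawQ_decAtT_of_twinGiant (y z g S lam : ℝ) (a j M k₁ k₂ : ℕ)
    (hy0 : 0 < y) (hy1 : y < 1) (hz0 : 0 ≤ z) (hz1 : z < 1) (hg1 : g ≤ 1) (hyg : y ≤ (1 - z) * g) (ha : 1 ≤ a)
    (hjM : j < M + a) (hk : k₁ ≤ k₂) (hk₂M : k₂ ≤ M) (hlam0 : 0 ≤ lam) (hlam1 : lam ≤ 1)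
    (hPgiant : j + 1 ≤ k₁ + a) :
    DECAtT y (S + (a : ℝ) * g * (1 - z)) j (M + a)
      (fun p => z * (if p = 0 then (1 : ℝ) else 0) + (1 - z) * slice (fun q => TP[k₁, k₂, lam, q]) a g p) := by
  classical
  set t : ℝ := S + (a : ℝ) * g * (1 - z) with ht
  set A : ℝ := (1 - z) * (1 - lam) * (1 - g) with hA
  set B : ℝ := (1 - z) * (1 - lam) * g with hB
  set C : ℝ := (1 - z) * lam * (1 - g) with hC
  set D : ℝ := (1 - z) * lam * g with hD
  have hg0 : 0 < g := by
    by_contra hc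
    have : (1 - z) * g ≤ 0 := mul_nonpos_of_nonneg_of_nonpos (by linarith) (not_lt.1 hc)
    linarith
  have h1z : 0 < 1 - z := by linarith
  have h1y : 0 < 1 - y := by linarith
  have hGgiant : j + 1 ≤ k₂ + a := by omega
  have hGneP : k₂ + a ≠ k₁ + a ∨ k₂ + a = k₁ + a := by omega
  -- the five-atom form (opaque name)
  obtain ⟨Q, hQdef⟩ : ∃ Q : ℕ → ℝ, ∀ p, Q p = z * (if p = 0 then (1 : ℝ) else 0) + A * (if p = k₁ then (1 : ℝ) else 0)
      + B * (if p = k₁ + a then (1 : ℝ) else 0) + C * (if p = k₂ then (1 : ℝ) else 0)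
      + D * (if p = k₂ + a then (1 : ℝ) else 0) := ⟨fun p => _, fun p => rfl⟩
  have hQp : ∀ p, z * (if p = 0 then (1 : ℝ) else 0) + (1 - z) * slice (fun q => TP[k₁, k₂, lam, q]) a g p = Q p := by
    intro p
    rw [hQdef, mixLawQ_eq_atoms'']
  obtain ⟨q0', qM', q1', -⟩ := gateCell_laws z g lam a M k₁ k₂ hz0 hz1.le hg0.le hg1 hlam0 hlam1 (hk.trans hk₂M) hk₂M
  have q0 : ∀ h, 0 ≤ Q h := fun h => by rw [← hQp h]; exact q0' h
  have qM : ∀ h, M + a < h → Q h = 0 := fun h hh => by rw [← hQp h]; exact qM' h hh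
  have q1 : ∑ h ∈ Finset.range (M + a + 1), Q h = 1 := by
    rw [← q1']; exact Finset.sum_congr rfl fun h _ => (hQp h).symm
  -- the giant mass is at least `B + D = (1−z)g ≥ y`
  set Gi : ℝ := ∑ h ∈ Finset.Ico (j + 1) (M + a + 1), Q h with hGi
  have hQP_ge : B ≤ Q (k₁ + a) := by
    rw [hQdef, if_neg (by omega : k₁ + a ≠ 0), if_neg (by omega : k₁ + a ≠ k₁), if_pos rfl]
    have hz' : 0 ≤ z * (if k₁ + a = 0 then (1:ℝ) else 0) := mul_nonneg hz0 (by split_ifs <;> norm_num)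
    have hC' : 0 ≤ C * (if k₁ + a = k₂ then (1:ℝ) else 0) :=
      mul_nonneg (mul_nonneg (mul_nonneg h1z.le hlam0) (by linarith)) (by split_ifs <;> norm_num)
    have hD' : 0 ≤ D * (if k₁ + a = k₂ + a then (1:ℝ) else 0) :=
      mul_nonneg (mul_nonneg (mul_nonneg h1z.le hlam0) hg0.le) (by split_ifs <;> norm_num)
    linarith
  have hQG_ge : D ≤ Q (k₂ + a) := by
    rw [hQdef, if_neg (by omega : k₂ + a ≠ 0), if_neg (by omega : k₂ + a ≠ k₁), if_neg (by omega : k₂ + a ≠ k₂), if_pos rfl]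
    have hB' : 0 ≤ B * (if k₂ + a = k₁ + a then (1:ℝ) else 0) :=
      mul_nonneg (mul_nonneg (mul_nonneg h1z.le (by linarith)) hg0.le) (by split_ifs <;> norm_num)
    linarith
  have hGi_ge : (1 - z) * g ≤ Gi := by
    rcases Nat.lt_or_ge k₁ k₂ with hlt | hge
    · -- distinct giants `k₁ + a < k₂ + a`
      have hsub : ({k₁ + a, k₂ + a} : Finset ℕ) ⊆ Finset.Ico (j + 1) (M + a + 1) := by
        intro x hx
        rw [Finset.mem_insert, Finset.mem_singleton] at hx
        rw [Finset.mem_Ico]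
        rcases hx with rfl | rfl <;> omega
      have h2 := Finset.sum_le_sum_of_subset_of_nonneg hsub (fun i _ _ => q0 i)
      rw [Finset.sum_pair (by omega : k₁ + a ≠ k₂ + a)] at h2
      have : (1 - z) * g = B + D := by rw [hB, hD]; ring
      rw [this]; linarith
    · -- `k₁ = k₂`: one giant carrying `B + D`
      have heq : k₁ = k₂ := le_antisymm hk hge
      have hmem : k₂ + a ∈ Finset.Ico (j + 1) (M + a + 1) := Finset.mem_Ico.2 ⟨hGgiant, by omega⟩
      have h2 := Finset.single_le_sum (fun i _ => q0 i) hmem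
      have hval : Q (k₂ + a) = B + D := by
        rw [hQdef, if_neg (by omega : k₂ + a ≠ 0), if_neg (by omega : k₂ + a ≠ k₁), heq, if_pos rfl,
          if_neg (by omega : k₂ + a ≠ k₂)]; ring
      have : (1 - z) * g = B + D := by rw [hB, hD]; ring
      rw [this, ← hval]; exact h2
  have hyGi : y ≤ Gi := hyg.trans hGi_ge
  -- the low mass is at most `1 − Gi`
  have hlow_le : ∑ l ∈ Finset.range (j + 1), (if 2 * (l : ℝ) < t then Q l else 0) ≤ 1 - Gi := by
    have h1 : ∑ l ∈ Finset.range (j + 1), (if 2 * (l : ℝ) < t then Q l else 0) ≤ ∑ l ∈ Finset.range (j + 1), Q l :=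
      Finset.sum_le_sum fun l _ => by split_ifs <;> [exact le_rfl; exact q0 l]
    have h2 : ∑ l ∈ Finset.range (j + 1), Q l + Gi = 1 := by
      rw [hGi, Finset.sum_range_add_sum_Ico Q (by omega : j + 1 ≤ M + a + 1), q1]
    linarith
  -- criterion E
  have hE : y / (1 - y) * ∑ l ∈ Finset.range (j + 1), (if 2 * (l : ℝ) < t then Q l else 0) ≤ Gi := by
    rw [div_mul_eq_mul_div, div_le_iff₀ h1y]
    have hL0 : 0 ≤ ∑ l ∈ Finset.range (j + 1), (if 2 * (l : ℝ) < t then Q l else 0) :=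
      Finset.sum_nonneg fun l _ => by split_ifs <;> [exact q0 l; exact le_rfl]
    nlinarith
  refine decAtT_congr (fun p => (hQp p).symm) ?_
  exact decAtT_of_flowAtT y t j (M + a) Q hy0 hy1 qM q1 (flowAtT_of_giants y t j (M + a) Q hy0 hy1 q0 hE)

/-- **`GatedSliceMixLaw'` in the shifted-copy-giant cell (θ = 0).**  Frame of the node and `j + 1 ≤ k₁ + a`; the weak-mid law, its non-DEC
hypothesis, `h`, the mean identity and top-affordability are not used. [this work] -/
theorem gatedSliceMixLaw'_of_twinGiant (y z g S lam : ℝ) (a j M h k₁ k₂ : ℕ)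
    (hy0 : 0 < y) (hy1 : y < 1) (hz0 : 0 ≤ z) (hz1 : z < 1) (hg1 : g ≤ 1) (hyg : y ≤ (1 - z) * g) (ha : 1 ≤ a)
    (hjM : j < M + a) (hk : k₁ ≤ k₂) (hk₂M : k₂ ≤ M) (hlam0 : 0 ≤ lam) (hlam1 : lam ≤ 1)
    (hPgiant : j + 1 ≤ k₁ + a) :
    ∃ θ : ℝ, 0 ≤ θ ∧ θ < 1 ∧
      DECAtT y (S + (a : ℝ) * g * (1 - z)) j (M + a)
        (fun p => θ * weakMidLaw S g h a p
          + (1 - θ) * (z * (if p = 0 then (1 : ℝ) else 0) + (1 - z) * slice (fun q => TP[k₁, k₂, lam, q]) a g p)) := by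
  refine ⟨0, le_rfl, zero_lt_one, ?_⟩
  refine decAtT_congr (fun p => ?_)
    (mixLawQ_decAtT_of_twinGiant y z g S lam a j M k₁ k₂ hy0 hy1 hz0 hz1 hg1 hyg ha hjM hk hk₂M hlam0 hlam1 hPgiant)
  ring

end LawDec

end Quant

end Summit.CriticalPhenomena.PercolationContinuityZ3.Theorems
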